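import Summits.QuantumFields.YangMills.Theorems.UnitScaleTiltProp7CellBoxMultiplicity
import HarnessLib

/-!
# Route `UnitScaleTilt`, crux K1 «MinimiserStabilityRegPr» (stmt-QuantumFields-19200), route-R E′ (A′)-on-Σ, P-A2 (β), row «(n3)-comb» `hMcomb` —
# lane (II) file F-6d-2a «CELL ROWS FOR THE PER-CORNER LETTERS»: the level-k cell sums of the five box functionals of the per-corner row (top-pair gradient ∕ mass, cube gradient ∕ mass,
# block rows) in the EXACT index shapes of ★routeR-w1 F-6c-2b ∕ w3-19200 F-6c-3b∕3c∕3d — `= L·GRADcell`, `= d·MASScell`, `≤ Aᵈ·(cell functional)` — generic nonnegative periodic data on `ℤᵈ`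

Cell `ym3-torus` (HUMAN RULING D-0037: YM₃ on the torus is ladder rung R3 — not d = 4, not a mass gap, not Clay), D-0154 (3c) R3 twin-width seat `ym-routeR-w6` (gen 9);
★routeR-w1 g9 PENS ROUND 4 (2026-08-29 08:50:39Z) «F-6d Σ OVER CORNERS + MULTIPLICITIES + TRANSFER KNIT → routeR-w6»; sequel of F-6d-1 ✓`…CellBoxMultiplicity` (the counting).
`--supports stmt-QuantumFields-19200 --as helper`; THEOREMS ONLY (0 `def`, 0 `sorry`); count-neutral.  «(O2) groundwork — route-internal row (n3)-comb, NOT N06, NOT a print row; OPEN».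
Nothing of `hMcomb`, `hMcomb₂`, (β), `hPA2`, `hcoS`, E′, EX, the stub, the crux, d = 4 or the gap is claimed.

THE POINT.  w3-19200 g13's per-corner row F-6c-3d ★`normSq_covGrad_gauge_le_of_stepMean` (= ✓F-6c-3a ∘ F-6c-3b ∘ F-6c-3c ∘ ★routeR-w1 ✓F-6c-2b) bounds `‖∇^{cov}Λ_{k′+1}(z, κ)‖²` at ONE
level-`(k′+1)` corner by explicit sums over boxes CORNERED AT THE CORNER CHAIN `L^{k′+1−i}•z` (and at the neighbour's chain `L^{k′+1−i}•(z + e_κ)`): the top pair's double block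
`Σ_{s ∈ [0,L)ᵈ} Σ_{t<L} (·)(L•z + s + t•e_κ)` and shifted block `Σ_s (·)(L•z + L•e_κ + s)` (F-6c-3b), the cubes `Σ_{ρ ∈ [0,n+1)ᵈ, ρ_ν ≠ n} (·)(L^{k′+1−j}•z + ρ)` and
`Σ_ρ (·)(L^{k′+1−j}•z + ρ)` (F-6c-2b's GRAD∕MASS), the defect blocks `Σ_{s′ ∈ [0,L)ᵈ}(·)(L^{k′−j}•z + s′)`, and ✓F-6a-2 §3's blocks `Σ_{s, s_ν+1 ≠ L}(·)(L^{k′+1−i}•z + s)`.  F-6d sums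
that row over the level-`(k′+1)` period cell `z = boxVec N′ z₀`, `κ`.  This file gives, for GENERIC nonnegative periodic real data (the knit F-6d-2b instantiates them with the covariant
gradient ∕ mass ∕ defect densities of the level fields), the resulting CELL functionals with their multiplicities, in exactly those index shapes (nesting of `Σ_μ Σ_ν Σ_ρ`, the `filter`s,
the `(L:ℤ)^e •` corners): top gradient `= L·Σ_cell` (F-6d-1 §4), top mass `= d·Σ_cell` (F-6d-1 `sum_cell_block_shift_eq`), cubes∕blocks `≤ Aᵈ·Σ_cell` whenever `side ≤ A·L^e` (F-6d-1 §3;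
`A = 2` for the cubes `n+1 = L²+L ≤ 2L²`, `A = 1` for every block below the top), filters dropped upward (terms `≥ 0`), at the corner chain AND at the neighbour's chain (same bound, F-6d-1 §1).

WHAT IS PROVED (ns `…Theorems.Prop7CornerCombCellRows`; generic `ℤᵈ`, every `d`; data `Site d → ℝ` (families indexed by directions), `N′`-cell at the top, fine cell `Nj = N′·L^e`).
* §1 `sum_cell_top_grad_eq` (`Σ_{z₀,κ,μ} Σ_sΣ_{t<L} f κ μ (L•z + s + t•e_κ) = L·Σ_{y ∈ cell} Σ_μΣ_κ f κ μ y` — component outside, direction inside: ★routeR-w4 F-7b's GRAD cell letter), `sum_cell_top_mass_eq` (`Σ_{z₀,κ,μ} Σ_s m μ (L•z + L•e_κ + s) = d·Σ_y Σ_μ m μ y`).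
* §2 `sum_filter_le_sum_of_nonneg'` (drop a filter), ★`sum_cell_cube_grad_shift_le` ∕ `sum_cell_cube_grad_le` (`Σ_{z₀} Σ_{μ′}Σ_νΣ_{ρ : P ν ρ} g ν μ′ (L^e•(z+v) + ρ) ≤ Aᵈ·Σ_y Σ_{μ′}Σ_ν g ν μ′ y`),
  ★`sum_cell_cube_mass_shift_le` ∕ `sum_cell_cube_mass_le` (`Σ_{z₀} Σ_{μ′}Σ_ρ m μ′ (…) ≤ Aᵈ·Σ_y Σ_{μ′} m μ′ y`), `sum_cell_block_mass_shift_le'` ∕ `sum_cell_block_mass_le'` (the `Σ_ρ Σ_μ` nesting of ✓F-6a-2 §3),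
  `sum_cell_box_fun_shift_le` ∕ `sum_cell_box_fun_le` (one function, one box: the defect blocks per component `μ`).
HONEST SCOPE.  Finite re-indexing; no field, no transport, no level recursion, no member.  Rung R3, not Clay; YM gap NOT proved.

References: T. Bałaban, CMP **98** (1985) 17–51 [Balaban1985Averaging] ((2) p.17, (42)–(47) pp.23–25, (125)–(126) p.36); CMP **109** (1987) 249–301 [Balaban1987RG1] ((0.1) p.251);
M. Giaquinta (1983) [Giaquinta1984] (Ch. III §1 p.70).
-/

set_option autoImplicit false

noncomputable section

open scoped BigOperators

namespace Summit.QuantumFields.YangMills.Theorems.Prop7CornerCombCellRows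

open Finset
open Literature.MathematicalPhysics.QuantumFieldTheory.Balaban1983to89
open B7Prop1Explicit (Site e boxVec)
open Summit.QuantumFields.YangMills.Theorems.Prop7CellBoxMultiplicity
  (sum_cell_shift_vec sum_cell_sum_box_le sum_cell_sum_box_shift_le sum_cell_block_shift_eq sum_cell_block_seg_eq)

variable {d : ℕ}

/-! ## §1 The top pair: double block `= L·cell`, shifted block `= d·cell` -/

/-- **TOP-PAIR GRADIENT ROW OVER THE CELL**: for `N′L`-periodic data `f κ μ`, `Σ_{z₀ ∈ [0,N′)ᵈ} Σ_κ Σ_μ Σ_{s ∈ [0,L)ᵈ} Σ_{t<L} f κ μ (L•z₀ + s + t•e_κ) = L·Σ_{y ∈ [0,N′L)ᵈ} Σ_μ Σ_κ f κ μ (y)` (the cell functional with the component `μ` OUTSIDE the direction `κ` — ★routeR-w4 F-7b's GRAD letter)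
(F-6d-1 §4 per `(κ, μ)`). The cell sum of F-6c-3b's first slot. [cite: Balaban1985Averaging, (42)-(47) pp.23-25; Balaban1987RG1, (0.1) p.251] -/
theorem sum_cell_top_grad_eq (N' L : ℕ) [NeZero N'] (hL : 1 ≤ L) (Nf : ℕ) (hNf : Nf = N' * L) (f : Fin d → Fin d → Site d → ℝ)
    (hfp : ∀ (κ μ : Fin d) (y : Site d) (ν : Fin d), f κ μ (y + (Nf : ℤ) • e ν) = f κ μ y) :
    ∑ z₀ : Fin d → Fin N', ∑ κ : Fin d, ∑ μ : Fin d, ∑ s : Fin d → Fin L, ∑ t ∈ range L, f κ μ ((L : ℤ) • boxVec N' z₀ + boxVec L s + (t : ℤ) • e κ)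
      = (L : ℝ) * ∑ y : Fin d → Fin Nf, ∑ μ : Fin d, ∑ κ : Fin d, f κ μ (boxVec Nf y) := by
  have hκμ : ∀ κ μ : Fin d, ∑ z₀ : Fin d → Fin N', ∑ s : Fin d → Fin L, ∑ t ∈ range L, f κ μ ((L : ℤ) • boxVec N' z₀ + boxVec L s + (t : ℤ) • e κ)
      = L • ∑ y : Fin d → Fin Nf, f κ μ (boxVec Nf y) := fun κ μ =>
    sum_cell_block_seg_eq N' L hL Nf hNf (f κ μ) (hfp κ μ) κ
  calc _ = ∑ κ : Fin d, ∑ μ : Fin d, ∑ z₀ : Fin d → Fin N', ∑ s : Fin d → Fin L, ∑ t ∈ range L, f κ μ ((L : ℤ) • boxVec N' z₀ + boxVec L s + (t : ℤ) • e κ) := by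
        rw [Finset.sum_comm]; exact Finset.sum_congr rfl fun κ _ => Finset.sum_comm
    _ = ∑ κ : Fin d, ∑ μ : Fin d, L • ∑ y : Fin d → Fin Nf, f κ μ (boxVec Nf y) :=
        Finset.sum_congr rfl fun κ _ => Finset.sum_congr rfl fun μ _ => hκμ κ μ
    _ = (L : ℝ) * ∑ κ : Fin d, ∑ μ : Fin d, ∑ y : Fin d → Fin Nf, f κ μ (boxVec Nf y) := by
        simp only [nsmul_eq_mul, Finset.mul_sum]
    _ = _ := by
        congr 1
        calc ∑ κ : Fin d, ∑ μ : Fin d, ∑ y : Fin d → Fin Nf, f κ μ (boxVec Nf y)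
            = ∑ κ : Fin d, ∑ y : Fin d → Fin Nf, ∑ μ : Fin d, f κ μ (boxVec Nf y) := Finset.sum_congr rfl fun κ _ => Finset.sum_comm
          _ = ∑ y : Fin d → Fin Nf, ∑ κ : Fin d, ∑ μ : Fin d, f κ μ (boxVec Nf y) := Finset.sum_comm
          _ = _ := Finset.sum_congr rfl fun y _ => Finset.sum_comm

/-- **TOP-PAIR MASS ROW OVER THE CELL**: for `N′L`-periodic data `m μ`, `Σ_{z₀} Σ_κ Σ_μ Σ_{s ∈ [0,L)ᵈ} m μ (L•z₀ + L•e_κ + s) = d·Σ_{y ∈ [0,N′L)ᵈ} Σ_μ m μ (y)` (F-6d-1 `sum_cell_block_shift_eq`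
at `v = e_κ` per `(κ, μ)`). The cell sum of F-6c-3b's second slot. [cite: Balaban1985Averaging, (2) p.17, (42)-(47) pp.23-25; Balaban1987RG1, (0.1) p.251] -/
theorem sum_cell_top_mass_eq (N' L : ℕ) [NeZero N'] (hL : 1 ≤ L) (Nf : ℕ) (hNf : Nf = N' * L) (m : Fin d → Site d → ℝ)
    (hmp : ∀ (μ : Fin d) (y : Site d) (ν : Fin d), m μ (y + (Nf : ℤ) • e ν) = m μ y) :
    ∑ z₀ : Fin d → Fin N', ∑ κ : Fin d, ∑ μ : Fin d, ∑ s : Fin d → Fin L, m μ ((L : ℤ) • boxVec N' z₀ + (L : ℤ) • e κ + boxVec L s)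
      = (d : ℝ) * ∑ y : Fin d → Fin Nf, ∑ μ : Fin d, m μ (boxVec Nf y) := by
  have hκμ : ∀ κ μ : Fin d, ∑ z₀ : Fin d → Fin N', ∑ s : Fin d → Fin L, m μ ((L : ℤ) • boxVec N' z₀ + (L : ℤ) • e κ + boxVec L s)
      = ∑ y : Fin d → Fin Nf, m μ (boxVec Nf y) := by
    intro κ μ
    have h := sum_cell_block_shift_eq N' L hL Nf hNf (m μ) (hmp μ) (e κ)
    simpa only [smul_add] using h
  calc _ = ∑ κ : Fin d, ∑ μ : Fin d, ∑ z₀ : Fin d → Fin N', ∑ s : Fin d → Fin L, m μ ((L : ℤ) • boxVec N' z₀ + (L : ℤ) • e κ + boxVec L s) := by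
        rw [Finset.sum_comm]; exact Finset.sum_congr rfl fun κ _ => Finset.sum_comm
    _ = ∑ κ : Fin d, ∑ μ : Fin d, ∑ y : Fin d → Fin Nf, m μ (boxVec Nf y) :=
        Finset.sum_congr rfl fun κ _ => Finset.sum_congr rfl fun μ _ => hκμ κ μ
    _ = ∑ κ : Fin d, ∑ y : Fin d → Fin Nf, ∑ μ : Fin d, m μ (boxVec Nf y) := Finset.sum_congr rfl fun κ _ => Finset.sum_comm
    _ = _ := by rw [Finset.sum_const, Finset.card_univ, Fintype.card_fin, nsmul_eq_mul]

/-! ## §2 Cubes and blocks at the corner chain: `≤ Aᵈ ·` cell functional, filters dropped -/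

/-- Dropping a filter under nonnegativity: `Σ_{x ∈ s.filter p} f x ≤ Σ_{x ∈ s} f x` for `f ≥ 0`. [folklore] -/
theorem sum_filter_le_sum_of_nonneg' {α : Type*} (s : Finset α) (p : α → Prop) [DecidablePred p] (f : α → ℝ) (hf : ∀ x, 0 ≤ f x) :
    ∑ x ∈ s.filter p, f x ≤ ∑ x ∈ s, f x :=
  Finset.sum_le_sum_of_subset_of_nonneg (Finset.filter_subset _ _) fun x _ _ => hf x

/-- **ONE FUNCTION, ONE BOX, SHIFTED CORNER**: `q ≥ 0` `Nj = N′·L^e`-periodic, box side `M ≤ A·L^e`; then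
`Σ_{z₀ ∈ [0,N′)ᵈ} Σ_{u ∈ [0,M)ᵈ} q (L^e•(z₀ + v) + u) ≤ Aᵈ·Σ_{y ∈ [0,Nj)ᵈ} q (y)` (F-6d-1 §3 with `s = L^e`). The defect blocks (`M = L`, `e = k′−j ≥ 1`, `A = 1`) per component.
[cite: Balaban1985Averaging, (2) p.17, (125)-(126) p.36; Giaquinta1984, Ch. III §1 p.70] -/
theorem sum_cell_box_fun_shift_le (N' L p M A : ℕ) [NeZero N'] (hL : 1 ≤ L) (hMA : M ≤ A * L ^ p) (Nj : ℕ) (hNj : Nj = N' * L ^ p)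
    (q : Site d → ℝ) (hq : ∀ y, 0 ≤ q y) (hqp : ∀ (y : Site d) (ν : Fin d), q (y + (Nj : ℤ) • e ν) = q y) (v : Site d) :
    ∑ z₀ : Fin d → Fin N', ∑ u : Fin d → Fin M, q (((L : ℤ) ^ p) • (boxVec N' z₀ + v) + boxVec M u)
      ≤ (A : ℝ) ^ d * ∑ y : Fin d → Fin Nj, q (boxVec Nj y) := by
  have hs : 1 ≤ L ^ p := Nat.one_le_pow _ _ hL
  have h := sum_cell_sum_box_shift_le N' (L ^ p) M A hs hMA Nj hNj q hq hqp v
  simpa only [Nat.cast_pow] using h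

/-- The same at the corner chain itself (`v = 0`). [cite: Balaban1985Averaging, (2) p.17, (125)-(126) p.36] -/
theorem sum_cell_box_fun_le (N' L p M A : ℕ) [NeZero N'] (hL : 1 ≤ L) (hMA : M ≤ A * L ^ p) (Nj : ℕ) (hNj : Nj = N' * L ^ p)
    (q : Site d → ℝ) (hq : ∀ y, 0 ≤ q y) (hqp : ∀ (y : Site d) (ν : Fin d), q (y + (Nj : ℤ) • e ν) = q y) :
    ∑ z₀ : Fin d → Fin N', ∑ u : Fin d → Fin M, q (((L : ℤ) ^ p) • boxVec N' z₀ + boxVec M u)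
      ≤ (A : ℝ) ^ d * ∑ y : Fin d → Fin Nj, q (boxVec Nj y) := by
  have h := sum_cell_box_fun_shift_le N' L p M A hL hMA Nj hNj q hq hqp 0
  simpa only [add_zero] using h

/-- ★ **CUBE GRADIENT ROW OVER THE CELL, SHIFTED CORNER** (F-6c-2b's GRAD letter and ✓F-6a-2 §3's, nesting `Σ_{μ′} Σ_ν Σ_{ρ filtered}`): `g ν μ′ ≥ 0` `Nj`-periodic, side `M ≤ A·L^e`, any
decidable filters `P ν`; then `Σ_{z₀} Σ_{μ′} Σ_ν Σ_{ρ ∈ [0,M)ᵈ, P ν ρ} g ν μ′ (L^e•(z₀ + v) + ρ) ≤ Aᵈ·Σ_{y ∈ [0,Nj)ᵈ} Σ_{μ′} Σ_ν g ν μ′ (y)` (component outside, direction inside — F-7b's GRAD letter).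
[cite: Balaban1985Averaging, (2) p.17, (125)-(126) p.36; Giaquinta1984, Ch. III §1 p.70] -/
theorem sum_cell_cube_grad_shift_le (N' L p M A : ℕ) [NeZero N'] (hL : 1 ≤ L) (hMA : M ≤ A * L ^ p) (Nj : ℕ) (hNj : Nj = N' * L ^ p)
    (g : Fin d → Fin d → Site d → ℝ) (hg : ∀ ν μ y, 0 ≤ g ν μ y) (hgp : ∀ (ν μ : Fin d) (y : Site d) (ι : Fin d), g ν μ (y + (Nj : ℤ) • e ι) = g ν μ y)
    (P : Fin d → (Fin d → Fin M) → Prop) [∀ ν, DecidablePred (P ν)] (v : Site d) :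
    ∑ z₀ : Fin d → Fin N', ∑ μ : Fin d, ∑ ν : Fin d, ∑ ρ ∈ univ.filter (P ν), g ν μ (((L : ℤ) ^ p) • (boxVec N' z₀ + v) + boxVec M ρ)
      ≤ (A : ℝ) ^ d * ∑ y : Fin d → Fin Nj, ∑ μ : Fin d, ∑ ν : Fin d, g ν μ (boxVec Nj y) := by
  -- drop the filters, then the cell multiplicity per `(ν, μ)`
  have h1 : ∀ (z₀ : Fin d → Fin N') (μ ν : Fin d), ∑ ρ ∈ univ.filter (P ν), g ν μ (((L : ℤ) ^ p) • (boxVec N' z₀ + v) + boxVec M ρ)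
      ≤ ∑ ρ : Fin d → Fin M, g ν μ (((L : ℤ) ^ p) • (boxVec N' z₀ + v) + boxVec M ρ) := fun z₀ μ ν =>
    sum_filter_le_sum_of_nonneg' _ _ _ fun ρ => hg ν μ _
  have h2 : ∀ μ ν : Fin d, ∑ z₀ : Fin d → Fin N', ∑ ρ : Fin d → Fin M, g ν μ (((L : ℤ) ^ p) • (boxVec N' z₀ + v) + boxVec M ρ)
      ≤ (A : ℝ) ^ d * ∑ y : Fin d → Fin Nj, g ν μ (boxVec Nj y) := fun μ ν =>
    sum_cell_box_fun_shift_le N' L p M A hL hMA Nj hNj (g ν μ) (hg ν μ) (hgp ν μ) v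
  calc _ ≤ ∑ z₀ : Fin d → Fin N', ∑ μ : Fin d, ∑ ν : Fin d, ∑ ρ : Fin d → Fin M, g ν μ (((L : ℤ) ^ p) • (boxVec N' z₀ + v) + boxVec M ρ) :=
        Finset.sum_le_sum fun z₀ _ => Finset.sum_le_sum fun μ _ => Finset.sum_le_sum fun ν _ => h1 z₀ μ ν
    _ = ∑ μ : Fin d, ∑ ν : Fin d, ∑ z₀ : Fin d → Fin N', ∑ ρ : Fin d → Fin M, g ν μ (((L : ℤ) ^ p) • (boxVec N' z₀ + v) + boxVec M ρ) := by
        rw [Finset.sum_comm]; exact Finset.sum_congr rfl fun μ _ => Finset.sum_comm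
    _ ≤ ∑ μ : Fin d, ∑ ν : Fin d, (A : ℝ) ^ d * ∑ y : Fin d → Fin Nj, g ν μ (boxVec Nj y) :=
        Finset.sum_le_sum fun μ _ => Finset.sum_le_sum fun ν _ => h2 μ ν
    _ = (A : ℝ) ^ d * ∑ μ : Fin d, ∑ ν : Fin d, ∑ y : Fin d → Fin Nj, g ν μ (boxVec Nj y) := by
        rw [Finset.mul_sum]; exact Finset.sum_congr rfl fun μ _ => by rw [Finset.mul_sum]
    _ = _ := by
        congr 1
        calc _ = ∑ μ : Fin d, ∑ y : Fin d → Fin Nj, ∑ ν : Fin d, g ν μ (boxVec Nj y) := Finset.sum_congr rfl fun μ _ => Finset.sum_comm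
          _ = _ := Finset.sum_comm

/-- ★ The same at the corner chain itself (`v = 0`). [cite: Balaban1985Averaging, (2) p.17, (125)-(126) p.36] -/
theorem sum_cell_cube_grad_le (N' L p M A : ℕ) [NeZero N'] (hL : 1 ≤ L) (hMA : M ≤ A * L ^ p) (Nj : ℕ) (hNj : Nj = N' * L ^ p)
    (g : Fin d → Fin d → Site d → ℝ) (hg : ∀ ν μ y, 0 ≤ g ν μ y) (hgp : ∀ (ν μ : Fin d) (y : Site d) (ι : Fin d), g ν μ (y + (Nj : ℤ) • e ι) = g ν μ y)
    (P : Fin d → (Fin d → Fin M) → Prop) [∀ ν, DecidablePred (P ν)] :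
    ∑ z₀ : Fin d → Fin N', ∑ μ : Fin d, ∑ ν : Fin d, ∑ ρ ∈ univ.filter (P ν), g ν μ (((L : ℤ) ^ p) • boxVec N' z₀ + boxVec M ρ)
      ≤ (A : ℝ) ^ d * ∑ y : Fin d → Fin Nj, ∑ μ : Fin d, ∑ ν : Fin d, g ν μ (boxVec Nj y) := by
  have h := sum_cell_cube_grad_shift_le N' L p M A hL hMA Nj hNj g hg hgp P 0
  simpa only [add_zero] using h

/-- ★ **CUBE MASS ROW OVER THE CELL, SHIFTED CORNER** (F-6c-2b's MASS letter, nesting `Σ_{μ′} Σ_ρ`): `m μ′ ≥ 0` `Nj`-periodic, side `M ≤ A·L^e`; then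
`Σ_{z₀} Σ_{μ′} Σ_{ρ ∈ [0,M)ᵈ} m μ′ (L^e•(z₀ + v) + ρ) ≤ Aᵈ·Σ_{y ∈ [0,Nj)ᵈ} Σ_{μ′} m μ′ (y)`. [cite: Balaban1985Averaging, (2) p.17, (125)-(126) p.36; Giaquinta1984, Ch. III §1 p.70] -/
theorem sum_cell_cube_mass_shift_le (N' L p M A : ℕ) [NeZero N'] (hL : 1 ≤ L) (hMA : M ≤ A * L ^ p) (Nj : ℕ) (hNj : Nj = N' * L ^ p)
    (m : Fin d → Site d → ℝ) (hm : ∀ μ y, 0 ≤ m μ y) (hmp : ∀ (μ : Fin d) (y : Site d) (ι : Fin d), m μ (y + (Nj : ℤ) • e ι) = m μ y) (v : Site d) :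
    ∑ z₀ : Fin d → Fin N', ∑ μ : Fin d, ∑ ρ : Fin d → Fin M, m μ (((L : ℤ) ^ p) • (boxVec N' z₀ + v) + boxVec M ρ)
      ≤ (A : ℝ) ^ d * ∑ y : Fin d → Fin Nj, ∑ μ : Fin d, m μ (boxVec Nj y) := by
  have h2 : ∀ μ : Fin d, ∑ z₀ : Fin d → Fin N', ∑ ρ : Fin d → Fin M, m μ (((L : ℤ) ^ p) • (boxVec N' z₀ + v) + boxVec M ρ)
      ≤ (A : ℝ) ^ d * ∑ y : Fin d → Fin Nj, m μ (boxVec Nj y) := fun μ =>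
    sum_cell_box_fun_shift_le N' L p M A hL hMA Nj hNj (m μ) (hm μ) (hmp μ) v
  calc _ = ∑ μ : Fin d, ∑ z₀ : Fin d → Fin N', ∑ ρ : Fin d → Fin M, m μ (((L : ℤ) ^ p) • (boxVec N' z₀ + v) + boxVec M ρ) := Finset.sum_comm
    _ ≤ ∑ μ : Fin d, (A : ℝ) ^ d * ∑ y : Fin d → Fin Nj, m μ (boxVec Nj y) := Finset.sum_le_sum fun μ _ => h2 μ
    _ = (A : ℝ) ^ d * ∑ μ : Fin d, ∑ y : Fin d → Fin Nj, m μ (boxVec Nj y) := by rw [Finset.mul_sum]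
    _ = _ := by rw [Finset.sum_comm]

/-- ★ The same at the corner chain itself (`v = 0`). [cite: Balaban1985Averaging, (2) p.17, (125)-(126) p.36] -/
theorem sum_cell_cube_mass_le (N' L p M A : ℕ) [NeZero N'] (hL : 1 ≤ L) (hMA : M ≤ A * L ^ p) (Nj : ℕ) (hNj : Nj = N' * L ^ p)
    (m : Fin d → Site d → ℝ) (hm : ∀ μ y, 0 ≤ m μ y) (hmp : ∀ (μ : Fin d) (y : Site d) (ι : Fin d), m μ (y + (Nj : ℤ) • e ι) = m μ y) :
    ∑ z₀ : Fin d → Fin N', ∑ μ : Fin d, ∑ ρ : Fin d → Fin M, m μ (((L : ℤ) ^ p) • boxVec N' z₀ + boxVec M ρ)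
      ≤ (A : ℝ) ^ d * ∑ y : Fin d → Fin Nj, ∑ μ : Fin d, m μ (boxVec Nj y) := by
  have h := sum_cell_cube_mass_shift_le N' L p M A hL hMA Nj hNj m hm hmp 0
  simpa only [add_zero] using h

/-- **BLOCK MASS ROW, `Σ_ρ Σ_μ` NESTING** (✓F-6a-2 §3's mass letter), shifted corner: `Σ_{z₀} Σ_{ρ} Σ_{μ} m μ (L^e•(z₀ + v) + ρ) ≤ Aᵈ·Σ_y Σ_μ m μ (y)`.
[cite: Balaban1985Averaging, (2) p.17, (125)-(126) p.36] -/
theorem sum_cell_block_mass_shift_le' (N' L p M A : ℕ) [NeZero N'] (hL : 1 ≤ L) (hMA : M ≤ A * L ^ p) (Nj : ℕ) (hNj : Nj = N' * L ^ p)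
    (m : Fin d → Site d → ℝ) (hm : ∀ μ y, 0 ≤ m μ y) (hmp : ∀ (μ : Fin d) (y : Site d) (ι : Fin d), m μ (y + (Nj : ℤ) • e ι) = m μ y) (v : Site d) :
    ∑ z₀ : Fin d → Fin N', ∑ ρ : Fin d → Fin M, ∑ μ : Fin d, m μ (((L : ℤ) ^ p) • (boxVec N' z₀ + v) + boxVec M ρ)
      ≤ (A : ℝ) ^ d * ∑ y : Fin d → Fin Nj, ∑ μ : Fin d, m μ (boxVec Nj y) := by
  have h := sum_cell_cube_mass_shift_le N' L p M A hL hMA Nj hNj m hm hmp v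
  calc _ = ∑ z₀ : Fin d → Fin N', ∑ μ : Fin d, ∑ ρ : Fin d → Fin M, m μ (((L : ℤ) ^ p) • (boxVec N' z₀ + v) + boxVec M ρ) :=
        Finset.sum_congr rfl fun z₀ _ => Finset.sum_comm
    _ ≤ _ := h

/-- The same at the corner chain itself (`v = 0`). [cite: Balaban1985Averaging, (2) p.17, (125)-(126) p.36] -/
theorem sum_cell_block_mass_le' (N' L p M A : ℕ) [NeZero N'] (hL : 1 ≤ L) (hMA : M ≤ A * L ^ p) (Nj : ℕ) (hNj : Nj = N' * L ^ p)
    (m : Fin d → Site d → ℝ) (hm : ∀ μ y, 0 ≤ m μ y) (hmp : ∀ (μ : Fin d) (y : Site d) (ι : Fin d), m μ (y + (Nj : ℤ) • e ι) = m μ y) :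
    ∑ z₀ : Fin d → Fin N', ∑ ρ : Fin d → Fin M, ∑ μ : Fin d, m μ (((L : ℤ) ^ p) • boxVec N' z₀ + boxVec M ρ)
      ≤ (A : ℝ) ^ d * ∑ y : Fin d → Fin Nj, ∑ μ : Fin d, m μ (boxVec Nj y) := by
  have h := sum_cell_block_mass_shift_le' N' L p M A hL hMA Nj hNj m hm hmp 0
  simpa only [add_zero] using h

end Summit.QuantumFields.YangMills.Theorems.Prop7CornerCombCellRows

end
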